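import Summits.Ventures.HodgeRepro2.T5InertGlobalToLocal
import Summits.Ventures.HodgeRepro2.T5AdicCompletionGaloisInvariance

/-!
# The local integers are generated by the global ones: `𝒪_{L_w} = 𝒪_{K_v} · 𝒪_L` (cell pub-hodge-repro2, seat p3)

Tier-5 N3 support — the integral-points question left open by files 224–226 (the record's `K_v` is the
stabiliser of the lattice `𝒪_{K⁺_v} ⊗ 𝒪_K` on the tensor side, seat p8's `hyperspecialSubgroup` the stabiliser
of `𝒪_w^n` on `K_w`; carrying one to the other needs «`𝒪_{K⁺_v} ⊗_{𝒪_{K⁺}} 𝒪_K → 𝒪_w` is onto»). On Mathlib's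
completions `K_v ⊆ L_w` of number fields (`w ∣ v`, seat p4's structure maps) this file proves:
* `mem_closure_range_of_mem_integers` — `𝒪_L` is dense in `𝒪_{L_w}` (the density of `L` in `L_w` and Mathlib's
  `exists_valuation_sub_lt_of_integer`: an element of `L` integral at `w` is approximated by `𝒪_L`);
* `algebraMap_base_eq` — the square `𝓞_K → K_v → L_w` = `𝓞_K → 𝓞_L → L → L_w` commutes (seat p8's
  `algebraMap_integers_global` read in `L_w`);
* **`exists_sum_smul_eq_of_mem_integers`** — for generators `l₁, …, l_r` of `𝓞_L` over `𝓞_K`, every `x ∈ 𝒪_{L_w}`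
  is `∑ aᵢ • lᵢ` with `aᵢ ∈ 𝒪_{K_v}`: the `𝒪_{K_v}`-span of `𝓞_L` is the image of the compact set
  `𝒪_{K_v}^r` under a continuous map (seat p4's `isCompact_adicCompletionIntegers`), hence closed, and contains
  the dense `𝓞_L`;
* `exists_generators`, **`setOf_exists_sum_smul_eq`** — with generators supplied by `Module.Finite 𝓞_K 𝓞_L`:
  `{∑ aᵢ • lᵢ : aᵢ ∈ 𝒪_{K_v}} = 𝒪_{L_w}` as sets.
No hypothesis on the place (split, inert or ramified).

Mathlib + seat p8's T5-156 (T5InertGlobalToLocal) + seat p4's T5AdicCompletionGaloisInvariance and their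
imports; no display; no device. §8(d): uses an L-value-free non-vanishing device: NO.
-/

namespace Summit.Ventures.HodgeRepro2.T5AdicCompletionIntegersSpan

open IsDedekindDomain IsDedekindDomain.HeightOneSpectrum NumberField Topology
open Summit.Ventures.HodgeRepro2.T5InertGlobalToLocal Summit.Ventures.HodgeRepro2.T5AdicCompletionGaloisInvariance

/-! ## `𝓞_L` is dense in `𝒪_{L_w}` -/

section Density

variable {L : Type*} [Field L] [NumberField L] (w : HeightOneSpectrum (𝓞 L))

/-- The image of `a ∈ 𝓞_L` in `L_w`. -/
noncomputable def intoCompletion (a : 𝓞 L) : w.adicCompletion L := algebraMap L (w.adicCompletion L) (algebraMap (𝓞 L) L a)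

/-- `intoCompletion a` unwrapped. -/
theorem intoCompletion_apply (a : 𝓞 L) : intoCompletion w a = algebraMap L (w.adicCompletion L) (algebraMap (𝓞 L) L a) := rfl

/-- `intoCompletion a` is integral. -/
theorem intoCompletion_mem (a : 𝓞 L) : intoCompletion w a ∈ w.adicCompletionIntegers L := by
  rw [intoCompletion_apply, mem_adicCompletionIntegers (𝓞 L) L w,
    show algebraMap L (w.adicCompletion L) (algebraMap (𝓞 L) L a) = ((algebraMap (𝓞 L) L a : L) : w.adicCompletion L)
      from rfl, valuedAdicCompletion_eq_valuation' w]
  exact valuation_le_one w a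

/-- The valuation of an element of `L_w` that is within `1` of an integral element is `≤ 1`. -/
theorem restrict_le_one_of_sub_lt_one {x y : w.adicCompletion L} (hx : Valued.v.restrict x ≤ 1)
    (h : Valued.v.restrict (y - x) < 1) : Valued.v.restrict y ≤ 1 := by
  have h1 : Valued.v.restrict y ≤ max (Valued.v.restrict (y - x)) (Valued.v.restrict x) := by
    have := Valuation.map_add Valued.v.restrict (y - x) x
    rwa [sub_add_cancel] at this
  exact h1.trans (max_le h.le hx)

/-- Two-step approximation in the value group: `v(a − x) < γ` from `v(a − l) < γ` and `v(l − x) < γ`. -/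
theorem restrict_sub_lt_of_lt_of_lt {a l x : w.adicCompletion L} {γ : MonoidWithZeroHom.ValueGroup₀ (.ofClass (Valued.v : Valuation (w.adicCompletion L) (WithZero (Multiplicative ℤ))))}
    (h₁ : Valued.v.restrict (a - l) < γ) (h₂ : Valued.v.restrict (l - x) < γ) :
    Valued.v.restrict (a - x) < γ := by
  have h3 : Valued.v.restrict (a - x) ≤ max (Valued.v.restrict (a - l)) (Valued.v.restrict (l - x)) := by
    have := Valuation.map_add Valued.v.restrict (a - l) (l - x)
    rwa [sub_add_sub_cancel] at this
  exact h3.trans_lt (max_lt h₁ h₂)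

/-- The image of a unit of the value group in `ℤᵐ⁰` is non-zero. -/
theorem embedding_ne_zero (γ : (MonoidWithZeroHom.ValueGroup₀ (.ofClass (Valued.v : Valuation (w.adicCompletion L) (WithZero (Multiplicative ℤ)))))ˣ) :
    MonoidWithZeroHom.ValueGroup₀.embedding γ.1 ≠ 0 := fun h =>
  γ.ne_zero (MonoidWithZeroHom.ValueGroup₀.embedding_strictMono.injective (h.trans (map_zero _).symm))

/-- **`𝓞_L` is dense in `𝒪_{L_w}`**: every integral `x ∈ L_w` is in the closure of the image of `𝓞_L`. -/
theorem mem_closure_range_of_mem_integers {x : w.adicCompletion L} (hx : x ∈ w.adicCompletionIntegers L) :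
    x ∈ closure (Set.range (intoCompletion w)) := by
  rw [mem_closure_iff_nhds]
  intro t ht
  obtain ⟨γ, hγ⟩ := Valued.mem_nhds.mp ht
  -- the ball of radius `γ` around `x`, inside the unit ball around `x`, is met by `L`
  have hB : ({y | Valued.v.restrict (y - x) < γ.1} ∩ {y | Valued.v.restrict (y - x) < 1}) ∈ 𝓝 x :=
    Filter.inter_mem (Valued.mem_nhds.mpr ⟨γ, subset_rfl⟩)
      (Valued.mem_nhds.mpr ⟨1, fun y hy => by rw [Set.mem_setOf_eq, Units.val_one] at hy; exact hy⟩)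
  have hd : x ∈ closure (Set.range (algebraMap L (w.adicCompletion L))) := by
    rw [(denseRange_algebraMap L w).closure_range]
    exact Set.mem_univ x
  obtain ⟨z, ⟨hz₁, hz₂⟩, l, rfl⟩ := mem_closure_iff_nhds.mp hd _ hB
  simp only [Set.mem_setOf_eq] at hz₁ hz₂
  -- `l` is integral at `w`
  have hx' : Valued.v.restrict x ≤ 1 :=
    Valued.v.restrict_le_one_iff.mpr ((mem_adicCompletionIntegers (𝓞 L) L w).mp hx)
  have hl : w.valuation L l ≤ 1 := by
    rw [← valuedAdicCompletion_eq_valuation' w, ← Valued.v.restrict_le_one_iff]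
    exact restrict_le_one_of_sub_lt_one w hx' hz₂
  -- approximate `l` by `𝓞_L` within `γ`
  obtain ⟨a, ha⟩ := exists_valuation_sub_lt_of_integer w hl (Units.mk0 _ (embedding_ne_zero w γ))
  refine ⟨intoCompletion w a, hγ ?_, a, rfl⟩
  have ha' : Valued.v.restrict (intoCompletion w a - algebraMap L (w.adicCompletion L) l) < γ.1 := by
    rw [Valued.v.restrict_lt_iff_lt_embedding, intoCompletion_apply, ← map_sub,
      show algebraMap L (w.adicCompletion L) (algebraMap (𝓞 L) L a - l) =
        ((algebraMap (𝓞 L) L a - l : L) : w.adicCompletion L) from rfl,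
      valuedAdicCompletion_eq_valuation' w]
    exact ha
  exact restrict_sub_lt_of_lt_of_lt w ha' hz₁

end Density

/-! ## The `𝒪_{K_v}`-span of `𝓞_L` is `𝒪_{L_w}` -/

section Span

variable {K : Type*} [Field K] [NumberField K] (v : HeightOneSpectrum (𝓞 K))
  {L : Type*} [Field L] [NumberField L] [Algebra K L] (w : HeightOneSpectrum (𝓞 L)) [w.asIdeal.LiesOver v.asIdeal]

/-- The square `𝓞_K → K_v → L_w` = `𝓞_K → 𝓞_L → L → L_w` commutes (seat p8's `algebraMap_integers_global`
read in `L_w`). -/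
theorem algebraMap_base_eq (c : 𝓞 K) :
    algebraMap (v.adicCompletion K) (w.adicCompletion L) (algebraMap (𝓞 K) (v.adicCompletion K) c) =
      intoCompletion w (algebraMap (𝓞 K) (𝓞 L) c) := by
  have h : ((algebraMap (v.adicCompletionIntegers K) (w.adicCompletionIntegers L)
        (algebraMap (𝓞 K) (v.adicCompletionIntegers K) c) : w.adicCompletionIntegers L) : w.adicCompletion L) =
      ((algebraMap (𝓞 L) (w.adicCompletionIntegers L) (algebraMap (𝓞 K) (𝓞 L) c) : w.adicCompletionIntegers L) :
        w.adicCompletion L) :=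
    congrArg Subtype.val (algebraMap_integers_global v w c)
  rw [coe_algebraMap_integers] at h
  exact h

/-- The `𝒪_{K_v}`-combinations of a family of elements of `𝓞_L`, as a map on `K_v^r`. -/
noncomputable def comb {r : ℕ} (l : Fin r → 𝓞 L) (a : Fin r → v.adicCompletion K) : w.adicCompletion L :=
  ∑ i, a i • intoCompletion w (l i)

/-- `comb` is continuous. -/
theorem continuous_comb {r : ℕ} (l : Fin r → 𝓞 L) : Continuous (comb v w l) :=
  continuous_finsetSum _ fun i _ => (continuous_apply i).smul continuous_const

/-- A combination with integral coefficients is integral. -/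
theorem comb_mem {r : ℕ} (l : Fin r → 𝓞 L) {a : Fin r → v.adicCompletion K}
    (ha : ∀ i, a i ∈ v.adicCompletionIntegers K) : comb v w l a ∈ w.adicCompletionIntegers L := by
  refine Subring.sum_mem _ fun i _ => ?_
  rw [Algebra.smul_def, ← coe_algebraMap_integers v w ⟨a i, ha i⟩]
  exact Subring.mul_mem _ (Subtype.mem _) (intoCompletion_mem w (l i))

/-- `𝓞_L` lies in the `𝒪_{K_v}`-combinations of its `𝓞_K`-generators. -/
theorem range_subset_image_comb {r : ℕ} (l : Fin r → 𝓞 L) (hl : Submodule.span (𝓞 K) (Set.range l) = ⊤) :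
    Set.range (intoCompletion w) ⊆ comb v w l '' Set.univ.pi fun _ => (v.adicCompletionIntegers K : Set (v.adicCompletion K)) := by
  rintro _ ⟨b, rfl⟩
  obtain ⟨c, hc⟩ := (Submodule.mem_span_range_iff_exists_fun (𝓞 K)).mp (hl ▸ Submodule.mem_top : b ∈ _)
  refine ⟨fun i => algebraMap (𝓞 K) (v.adicCompletion K) (c i), fun i _ => coe_algebraMap_mem _ _ _ _, ?_⟩
  rw [comb, ← hc]
  simp only [intoCompletion_apply, map_sum]
  refine Finset.sum_congr rfl fun i _ => ?_
  rw [Algebra.smul_def, algebraMap_base_eq, Algebra.smul_def, map_mul, map_mul, intoCompletion_apply]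

/-- **THE LOCAL INTEGERS ARE GENERATED BY THE GLOBAL ONES**: for generators `l₁, …, l_r` of `𝓞_L` over `𝓞_K`, every
`x ∈ 𝒪_{L_w}` is `∑ aᵢ • lᵢ` with `aᵢ ∈ 𝒪_{K_v}` — the `𝒪_{K_v}`-combinations form a compact (hence closed) set
containing the dense `𝓞_L`. -/
theorem exists_sum_smul_eq_of_mem_integers {r : ℕ} (l : Fin r → 𝓞 L)
    (hl : Submodule.span (𝓞 K) (Set.range l) = ⊤) {x : w.adicCompletion L} (hx : x ∈ w.adicCompletionIntegers L) :
    ∃ a : Fin r → v.adicCompletionIntegers K, x = ∑ i, ((a i : v.adicCompletion K) • intoCompletion w (l i)) := by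
  have hcl : IsClosed (comb v w l '' Set.univ.pi fun _ => (v.adicCompletionIntegers K : Set (v.adicCompletion K))) :=
    ((isCompact_univ_pi fun _ => isCompact_adicCompletionIntegers v).image (continuous_comb v w l)).isClosed
  have hsub := closure_minimal (range_subset_image_comb v w l hl) hcl
  obtain ⟨a, ha, rfl⟩ := hsub (mem_closure_range_of_mem_integers w hx)
  exact ⟨fun i => ⟨a i, ha i (Set.mem_univ i)⟩, rfl⟩

/-- `𝓞_L` has a finite generating family over `𝓞_K` (Mathlib's `Module.Finite 𝓞_K 𝓞_L`). -/
theorem exists_generators : ∃ (r : ℕ) (l : Fin r → 𝓞 L), Submodule.span (𝓞 K) (Set.range l) = ⊤ :=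
  Module.Finite.exists_fin

/-- **`{∑ aᵢ • lᵢ : aᵢ ∈ 𝒪_{K_v}} = 𝒪_{L_w}`** for generators `l` of `𝓞_L` over `𝓞_K`. -/
theorem setOf_exists_sum_smul_eq {r : ℕ} (l : Fin r → 𝓞 L) (hl : Submodule.span (𝓞 K) (Set.range l) = ⊤) :
    {x : w.adicCompletion L | ∃ a : Fin r → v.adicCompletionIntegers K,
        x = ∑ i, ((a i : v.adicCompletion K) • intoCompletion w (l i))} =
      (w.adicCompletionIntegers L : Set (w.adicCompletion L)) := by
  ext x
  constructor
  · rintro ⟨a, rfl⟩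
    exact comb_mem v w l fun i => (a i).2
  · intro hx
    exact exists_sum_smul_eq_of_mem_integers v w l hl hx

end Span

end Summit.Ventures.HodgeRepro2.T5AdicCompletionIntegersSpan
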